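import Summits.BirchSwinnertonDyer.Rank1Residual.GaloisImage.ThreeTorsionCubeRootDelta
import Literature.NumberTheory.EllipticCurves.SemistableModPImageIrreducibleProofs
import Literature.NumberTheory.EllipticCurves.SerreOpenImageDeterminantProofs
import Literature.NumberTheory.EllipticCurves.Rank1Residual.Predicates
import Mathlib.FieldTheory.KummerPolynomial
import Mathlib.NumberTheory.Real.Irrational
import HarnessLib

/-!
# `Δ(E) ∉ ℚ׳ ⟹ 3 ∣ #ρ̄_{E,3}(Γ_ℚ)`; hence `E[3]` irreducible and `Δ` not a cube ⟹ `ρ̄_{E,3}` onto,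
# and every irreducible NON-surjective mod-`3` image has CUBE discriminant and CUBE `j`
# (cell `b2b-bsdres`, team n1011, seat p02 gen 7 — TOOL file; O8@3 dictionary / one-witness surj(3)
# certificate; lead R5-77 idle rule, names notice HOME/INBOX 2026-08-21T20:2xZ)

HONEST FRAMING (cell `b2b-bsdres`, run/shared/lean/b2b/bsd-rank1-residual/, verbatim in every
file): the goal of the cell is to DELETE the COMBINATION-SHAPED residual classes of the
Birch–Swinnerton-Dyer formula for ALL analytic-rank `≤ 1` elliptic curves over `ℚ` — "full BSD
formula for every rank `≤ 1` curve in class `C`" assembled STRICTLY from published theorems — so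
that the rank-`≤ 1` remainder becomes exactly the CONSTRUCTION-SHAPED classes, which are TYPED
(missing-input `Prop`s), NOT attempted. This is not "finishing BSD". Team n1011 (N10 / N11 / O8
image strand): research route; no claim beyond the stated classes; labels UNCHANGED; nothing is
booked. Theorems only (no definition, no named fact); a TOOL file: nothing here is a class theorem.

## What this file proves

For an elliptic curve `E = W/K` (`char K = 0`; `K = ℚ` from §2 on):

* §1 `natCard_range_galoisRepTorsion_eq_finrank_divisionField` — **`#ρ̄_{E,n}(Γ_K) = [K(E[n]) : K]`**
  (the restriction `Γ_K → Gal(K(E[n])/K)` is onto with kernel `ker ρ̄_{E,n}`; tree `DivisionField`);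
  `three_dvd_finrank_divisionField_three_of_forall_pow_ne` — if `Δ` is not a cube in `K` then
  `3 ∣ [K(E[3]) : K]`: the cube root `δ ∈ K(E[3])` of n1011-p02 gen 4's
  `exists_cubeRoots_Δ_mem_divisionField_three` (Serre 1972 §5.3: `K(E[3]) ⊇ K(μ₃, ∛Δ)`) generates
  `K(δ)` of degree `3` (`X³ − Δ` irreducible, Mathlib `X_pow_sub_C_irreducible_iff_of_prime`), and
  degrees are multiplicative; hence `three_dvd_natCard_range_galoisRepTorsion_three_of_forall_pow_ne`.
* §2 (`K = ℚ`) **`surj_three_of_irr_of_forall_pow_ne_Δ`** — `E[3]` irreducible and `Δ ∉ ℚ׳` ⟹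
  `ρ̄_{E,3}` onto: a subgroup of `GL₂(𝔽₃)` with surjective determinant, no invariant line and order
  divisible by `3` is everything (Serre 1972 §2.4 Prop. 15; tree
  `not_dvd_card_of_not_hasSurjectiveModNGaloisRep` in a frame `exists_frame_galoisRepTorsion_rat`);
  contrapositive **`exists_pow_three_eq_Δ_of_irr_of_not_surj`** and `exists_pow_three_eq_j_of_irr_of_not_surj`
  — **every curve with `E[3]` irreducible and `ρ̄_{E,3}` NOT onto (the O8 image strand at `3`:
  `3Nn` / `3Ns`) has `Δ ∈ ℚ׳` and `j ∈ ℚ׳`**; class form `ClassX4.exists_pow_three_eq_j_of_not_surj`.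
* §3 the records-facing certificate `surj_three_of_irr_of_Δ_eq_of_pow_lt_of_lt_pow` — `E[3]`
  irreducible, `Δ(W) = d ∈ ℤ` and an integer `m` with `m³ < d < (m+1)³` (two `norm_num` lines)
  ⟹ `ρ̄_{E,3}` onto (a rational cube root of an integer is an integer, Mathlib
  `irrational_nrt_of_notint_nrt`).  This is a ONE-Frobenius alternative to the two-prime
  `hasSurjectiveModNGaloisRep_of_intModel_of_irr_of_order` (x11c gen 6): the order-`3` witness is
  replaced by "`Δ` is not a cube".

Not proved here (not needed by any consumer): the converse "`Δ ∈ ℚ׳ ⟹ ρ̄_{E,3}` not onto", which is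
the identification `ℚ(E[3])^{Q₈} = ℚ(μ₃, ∛Δ)` of the `𝔖₃`-quotient of `GL₂(𝔽₃)`.

Census reading (EVIDENCE, RESIDUAL-MAP §I O8, rmap-2 galrep split): the 1 334 S-b X4 pairs at the
additive prime `3` with non-surjective `ρ̄_{E,3}` (3Nn 910 / 3Ns 424) all have irreducible `E[3]`
(class X4), so by §2 each has a cube minimal discriminant; nothing is booked and no label moves — O8
stays OPEN (its missing input is a small-image Euler-system argument, untouched here).

References: [Serre1972] §2.4 Prop. 15, §5.3, §5.4; [SilvermanAEC2009] III.1, VIII.§1;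
[Zywina2015] §1.1 (images at `ℓ = 3`).
-/

noncomputable section

open scoped Classical

open WeierstrassCurve Polynomial Literature.NumberTheory.EllipticCurves
  Literature.NumberTheory.EllipticCurves.Rank1Residual
  Literature.NumberTheory.GaloisRepresentations

namespace Summit.BirchSwinnertonDyer.Rank1Residual.GaloisImage

universe u

/-! ### §1 `#ρ̄_{E,n}(Γ_K) = [K(E[n]) : K]` and `Δ ∉ K׳ ⟹ 3 ∣ [K(E[3]) : K]` -/

section General

variable {K : Type u} [Field K] [CharZero K] (W : WeierstrassCurve K) [W.IsElliptic]

omit [CharZero K] [W.IsElliptic] in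
/-- `ρ̄_{E,n}(σ) = 1` iff `σ` fixes `E[n]` pointwise. [folklore] -/
theorem galoisRepTorsion_eq_one_iff (n : ℤ) (σ : Field.absoluteGaloisGroup K) :
    galoisRepTorsion W n σ = 1 ↔ ∀ T : geomTorsion W n, σ • T = T := by
  constructor
  · intro h T
    rw [← galoisRepTorsion_apply, h]
    rfl
  · intro h
    refine Multiplicative.toAdd.injective (AddEquiv.ext fun T ↦ ?_)
    rw [galoisRepTorsion_apply]
    exact h T

/-- The kernel of the restriction `Γ_K → Gal(K(E[n])/K)` is `ker ρ̄_{E,n}` (`E` elliptic, `n ≠ 0`).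
[cite: SilvermanAEC2009, VIII.§1] -/
theorem ker_absRestrictNormalHom_divisionField (n : ℕ) [NeZero n] :
    (absRestrictNormalHom (W.divisionField n)).ker = (galoisRepTorsion W (n : ℤ)).ker := by
  ext σ
  rw [MonoidHom.mem_ker, W.absRestrictNormalHom_divisionField_eq_one_iff n σ, MonoidHom.mem_ker,
    galoisRepTorsion_eq_one_iff]

/-- **`#ρ̄_{E,n}(Γ_K) = [K(E[n]) : K]`**: the image of the mod-`n` representation is
`Gal(K(E[n])/K)` (restriction `Γ_K → Gal(K(E[n])/K)` is onto with kernel `ker ρ̄_{E,n}`), whose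
order is the degree of the Galois extension `K(E[n])/K`. [cite: SilvermanAEC2009, VIII.§1] -/
theorem natCard_range_galoisRepTorsion_eq_finrank_divisionField (n : ℕ) [NeZero n] :
    Nat.card (galoisRepTorsion W (n : ℤ)).range = Module.finrank K (W.divisionField n) := by
  have hsurj : Function.Surjective (absRestrictNormalHom (W.divisionField n)) := fun τ ↦ by
    obtain ⟨σ, hσ⟩ := AlgEquiv.restrictNormalHom_surjective (F := K) (K₁ := W.divisionField n)
      (E := AlgebraicClosure K) τ
    exact ⟨(Field.absoluteGaloisGroup.toAlgEquiv K).symm σ, by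
      rw [← hσ]; simp [absRestrictNormalHom]⟩
  rw [← Subgroup.index_ker, ← ker_absRestrictNormalHom_divisionField, Subgroup.index_ker,
    MonoidHom.range_eq_top_of_surjective _ hsurj, Subgroup.card_top, IsGalois.card_aut_eq_finrank]

/-- **`Δ ∉ K׳ ⟹ 3 ∣ [K(E[3]) : K]`**: a cube root `δ` of `Δ` lies in `K(E[3])` (Serre 1972 §5.3,
tree `exists_cubeRoots_Δ_mem_divisionField_three`), `X³ − Δ` is irreducible over `K` when `Δ` is
not a cube (Kummer), so `[K(δ) : K] = 3` divides `[K(E[3]) : K]`. [cite: Serre1972, §5.3] -/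
theorem three_dvd_finrank_divisionField_three_of_forall_pow_ne (hΔ : ∀ b : K, b ^ 3 ≠ W.Δ) :
    3 ∣ Module.finrank K (W.divisionField 3) := by
  obtain ⟨-, δ, -, hδ, hδmem, -, -⟩ := exists_cubeRoots_Δ_mem_divisionField_three W
  have hirr : Irreducible (X ^ 3 - C W.Δ : K[X]) :=
    (X_pow_sub_C_irreducible_iff_of_prime Nat.prime_three).mpr hΔ
  have hmonic : (X ^ 3 - C W.Δ : K[X]).Monic := monic_X_pow_sub_C _ (by norm_num)
  have hroot : Polynomial.aeval δ (X ^ 3 - C W.Δ : K[X]) = 0 := by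
    simp only [map_sub, map_pow, aeval_X, aeval_C, hδ, sub_self]
  have hmin : minpoly K δ = X ^ 3 - C W.Δ := (minpoly.eq_of_irreducible_of_monic hirr hroot hmonic).symm
  have hint : IsIntegral K δ := Algebra.IsIntegral.isIntegral δ
  have hdeg : Module.finrank K (IntermediateField.adjoin K {δ}) = 3 := by
    rw [IntermediateField.adjoin.finrank hint, hmin, natDegree_X_pow_sub_C]
  have hle : IntermediateField.adjoin K {δ} ≤ W.divisionField 3 :=
    IntermediateField.adjoin_simple_le_iff.mpr hδmem
  have hdvd := IntermediateField.finrank_dvd_of_le_right hle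
  rwa [hdeg] at hdvd

/-- **`Δ ∉ K׳ ⟹ 3 ∣ #ρ̄_{E,3}(Γ_K)`.** [cite: Serre1972, §5.3] -/
theorem three_dvd_natCard_range_galoisRepTorsion_three_of_forall_pow_ne (hΔ : ∀ b : K, b ^ 3 ≠ W.Δ) :
    3 ∣ Nat.card (galoisRepTorsion W ((3 : ℕ) : ℤ)).range := by
  haveI : NeZero (3 : ℕ) := ⟨by norm_num⟩
  rw [natCard_range_galoisRepTorsion_eq_finrank_divisionField W 3]
  exact three_dvd_finrank_divisionField_three_of_forall_pow_ne W hΔ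

end General

/-! ### §2 Over `ℚ`: irreducible and `Δ ∉ ℚ׳` ⟹ onto; irreducible non-surjective ⟹ cube `Δ`, `j` -/

section Rat

variable (W : WeierstrassCurve ℚ) [W.IsElliptic]

/-- **`E[3]` irreducible and `Δ(E)` not a cube in `ℚ` ⟹ `ρ̄_{E,3}` is onto `Aut(E[3]) ≅ GL₂(𝔽₃)`.**
The image `G` has surjective determinant (`χ̄₃`) and no invariant line; by §1, `3 ∣ #G`; Serre's
Prop. 15 then forces `G = GL₂(𝔽₃)` (tree `not_dvd_card_of_not_hasSurjectiveModNGaloisRep`).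
[cite: Serre1972, §2.4 Prop. 15 and §5.3] -/
theorem surj_three_of_irr_of_forall_pow_ne_Δ [Fact (Nat.Prime 3)] (hirr : Irr W 3)
    (hΔ : ∀ b : ℚ, b ^ 3 ≠ W.Δ) : Surj W 3 := by
  by_contra hns
  obtain ⟨e, Φ, he, -⟩ := exists_frame_galoisRepTorsion_rat W 3
  have h := not_dvd_card_of_not_hasSurjectiveModNGaloisRep W 3 Φ e he hirr hns
  rw [card_map_range_galoisRepTorsion W 3 Φ] at h
  exact h (three_dvd_natCard_range_galoisRepTorsion_three_of_forall_pow_ne W hΔ)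

/-- **`E[3]` irreducible and `ρ̄_{E,3}` NOT onto ⟹ `Δ(E) ∈ ℚ׳`** (the O8 image strand at `3`:
images `3Nn` / `3Ns`, the `2`-groups of `GL₂(𝔽₃)` with full determinant). [cite: Serre1972, §2.4 Prop. 15 and §5.3] -/
theorem exists_pow_three_eq_Δ_of_irr_of_not_surj [Fact (Nat.Prime 3)] (hirr : Irr W 3)
    (hns : ¬ Surj W 3) : ∃ b : ℚ, b ^ 3 = W.Δ := by
  by_contra h
  push Not at h
  exact hns (surj_three_of_irr_of_forall_pow_ne_Δ W hirr h)

/-- **… and `j(E) ∈ ℚ׳`** (`j = c₄³/Δ`). [cite: Serre1972, §2.4 Prop. 15 and §5.3] -/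
theorem exists_pow_three_eq_j_of_irr_of_not_surj [Fact (Nat.Prime 3)] (hirr : Irr W 3)
    (hns : ¬ Surj W 3) : ∃ r : ℚ, r ^ 3 = W.j := by
  obtain ⟨b, hb⟩ := exists_pow_three_eq_Δ_of_irr_of_not_surj W hirr hns
  refine ⟨W.c₄ / b, ?_⟩
  rw [div_pow, hb, WeierstrassCurve.j, Units.val_inv_eq_inv_val, WeierstrassCurve.coe_Δ',
    div_eq_mul_inv, mul_comm]

/-- Class form: **an X4 pair at `3` with `ρ̄_{E,3}` not onto (census: the O8 rows at `3`) has
`j ∈ ℚ׳`.** [cite: Serre1972, §2.4 Prop. 15 and §5.3] -/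
theorem ClassX4.exists_pow_three_eq_j_of_not_surj [Fact (Nat.Prime 3)] (hX : ClassX4 W 3)
    (hns : ¬ Surj W 3) : ∃ r : ℚ, r ^ 3 = W.j :=
  exists_pow_three_eq_j_of_irr_of_not_surj W hX.2.2 hns

/-! ### §3 The records-facing certificate: `Δ = d ∈ ℤ`, `m³ < d < (m+1)³` -/

/-- A rational cube root of an integer is an integer (rational root theorem; Mathlib
`irrational_nrt_of_notint_nrt`): if `d ∈ ℤ` lies strictly between two consecutive integer cubes,
it is not the cube of a rational number. [folklore] -/
theorem forall_pow_three_ne_of_pow_lt_of_lt_pow {d m : ℤ} (hlo : m ^ 3 < d) (hhi : d < (m + 1) ^ 3)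
    (b : ℚ) : b ^ 3 ≠ (d : ℚ) := by
  intro hb
  -- `b` is an integer: otherwise `(b : ℝ)` would be irrational
  have hint : ∃ y : ℤ, (b : ℝ) = y := by
    by_contra hne
    have hirr := irrational_nrt_of_notint_nrt (x := (b : ℝ)) 3 d (by exact_mod_cast hb) hne
      (by norm_num)
    exact hirr ⟨b, rfl⟩
  obtain ⟨y, hy⟩ := hint
  have hyb : (y : ℚ) = b := by exact_mod_cast hy.symm
  have hy3 : y ^ 3 = d := by exact_mod_cast (show ((y : ℚ)) ^ 3 = d by rw [hyb, hb])
  -- `m < y < m + 1` is impossible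
  have hmono : StrictMono fun a : ℤ ↦ a ^ 3 := Odd.strictMono_pow (by decide)
  have h1 : m < y := hmono.lt_iff_lt.mp (by simpa only [hy3] using hlo)
  have h2 : y < m + 1 := hmono.lt_iff_lt.mp (by simpa only [hy3] using hhi)
  omega

/-- **One-Frobenius surjectivity certificate at `3`: `E[3]` irreducible, `Δ(W) = d ∈ ℤ` with
`m³ < d < (m + 1)³` for some integer `m` ⟹ `ρ̄_{E,3}` onto.** [cite: Serre1972, §2.4 Prop. 15 and §5.3] -/
theorem surj_three_of_irr_of_Δ_eq_of_pow_lt_of_lt_pow [Fact (Nat.Prime 3)] (hirr : Irr W 3)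
    {d m : ℤ} (hΔ : W.Δ = d) (hlo : m ^ 3 < d) (hhi : d < (m + 1) ^ 3) : Surj W 3 :=
  surj_three_of_irr_of_forall_pow_ne_Δ W hirr fun b hb ↦
    forall_pow_three_ne_of_pow_lt_of_lt_pow hlo hhi b (hb.trans hΔ)

end Rat

end Summit.BirchSwinnertonDyer.Rank1Residual.GaloisImage
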